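import Summits.ValiantsHypothesis.ValiantsHypothesis.Theorems.KPlusLogSqLawValuativeDoorProgressionFree

/-!
# LINE `valuative_door` (crux `WeakLifting`, stmt-ValiantsHypothesis-19561) — GENERAL `2 × 2` LETTERS: coincidence binomials cancellation-free
# ⇒ at most `4K − 2` dominant exponents (`npEdges ≤ 4K − 3`), every non-archimedean field, every residue characteristic

HONEST FRAMING.  Helper (cell `pub-symmetroid`, seat val-sym-lift-p1 g24, 2026-08-29; `--supports 19561 --as helper`), the general-letter
companion of the landed `…ValuativeDoorProgressionFree` (symmetric letters: the Sidon row `3K − 4`).  For GENERAL letters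
`M_l = !![a_l, b_l; γ_l, δ_l]` the determinant is `a·δ − b·γ` with FOUR different entry polynomials, so the sweep's ties are the four-term
coincidences `d_{l₁} + d_{l₂} = d_{l₃} + d_{l₄}` of the support (on a Sidon support: `{l₁, l₂} = {l₃, l₄}`, i.e. the cross binomials
`a_{l₁} δ_{l₂} − b_{l₁} γ_{l₂}`, `a_{l₁} δ_{l₂} − b_{l₂} γ_{l₁}` and the letter determinants).  THEOREM (`valCoincidenceFree_unfolded`, all `K`):
on an injective support, if every coincidence binomial `a_{l₁} δ_{l₂} − b_{l₃} γ_{l₄}` (`d_{l₁} + d_{l₂} = d_{l₃} + d_{l₄}`) is cancellation-free then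
`Dom(det) ⊆ Dom(a δ) ∪ Dom(b γ)` has at most `(2K − 1) + (2K − 1)` elements: `npEdges ≤ 4K − 3` — in EVERY residue characteristic (the landed
general Sidon rows are `4K − 7` for `v 2 = 1`, ✓ `valGenSidonTwo_unitTwo_unfolded`, and `5K − 11` in general, ✓ `valGenSidonTwo_unfolded`; this
conditional bound is not sharp — the chain bookkeeping of the symmetric file is not repeated here).  Nothing here is a stub of the line or
closes anything; no bearing on vW / vB, `TropicalB`, `MatrixDescartes` (18050) or VP ≠ VNP.  [sweep + landed product count]
-/

set_option linter.dupNamespace false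
set_option autoImplicit false

namespace Summit.ValiantsHypothesis.ValiantsHypothesis.Theorems.KPlusLogSqLaw.ValDoor

open Polynomial Finset
open scoped BigOperators Classical

variable {F : Type*} [Field F]

/-- **GENERAL `2 × 2` LETTERS (all `K`, every non-archimedean field): at most `4K − 2` dominant exponents** for `det Σ_l X^{d_l} M_l`
on an injective support, provided every coincidence binomial `a_{l₁} δ_{l₂} − b_{l₃} γ_{l₄}` with `d_{l₁} + d_{l₂} = d_{l₃} + d_{l₄}` is
cancellation-free (`M_l = !![a_l, b_l; γ_l, δ_l]`). [sweep + landed product count] -/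
theorem card_dominant_det_two_le (v : AbsoluteValue F ℝ) (hv : IsNonarchimedean v) {K : ℕ} (d : Fin K → ℕ)
    (hd : Function.Injective d) (M : Fin K → Matrix (Fin 2) (Fin 2) F)
    (hfree : ∀ l₁ l₂ l₃ l₄ : Fin K, d l₁ + d l₂ = d l₃ + d l₄ →
      v (M l₁ 0 0 * M l₂ 1 1 - M l₃ 0 1 * M l₄ 1 0) = max (v (M l₁ 0 0 * M l₂ 1 1)) (v (M l₃ 0 1 * M l₄ 1 0))) :
    ((Matrix.det (∑ l, ((X : F[X]) ^ d l) • (M l).map (C : F →+* F[X]))).support.filter fun E =>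
        ∃ r : ℝ, 0 < r ∧ ∀ E' ∈ (Matrix.det (∑ l, ((X : F[X]) ^ d l) • (M l).map (C : F →+* F[X]))).support, E' ≠ E →
          v ((Matrix.det (∑ l, ((X : F[X]) ^ d l) • (M l).map (C : F →+* F[X]))).coeff E') * r ^ E'
            < v ((Matrix.det (∑ l, ((X : F[X]) ^ d l) • (M l).map (C : F →+* F[X]))).coeff E) * r ^ E).card
      ≤ 4 * K - 2 := by
  have hentry : ∀ i j : Fin 2, (∑ l, ((X : F[X]) ^ d l) • (M l).map (C : F →+* F[X])) i j = ∑ l, C (M l i j) * X ^ d l := by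
    intro i j
    rw [Matrix.sum_apply]
    refine Finset.sum_congr rfl fun l _ => ?_
    rw [Matrix.smul_apply, Matrix.map_apply, smul_eq_mul, mul_comm]
  rw [Matrix.det_fin_two, hentry, hentry, hentry, hentry]
  set a : F[X] := ∑ l, C (M l 0 0) * X ^ d l with ha
  set dd : F[X] := ∑ l, C (M l 1 1) * X ^ d l with hdd
  set b : F[X] := ∑ l, C (M l 0 1) * X ^ d l with hb
  set c : F[X] := ∑ l, C (M l 1 0) * X ^ d l with hc
  have hAP : ∀ (r : ℝ) (X Y Z W : ℕ), 0 < r → a.coeff X ≠ 0 → dd.coeff Y ≠ 0 → b.coeff Z ≠ 0 → c.coeff W ≠ 0 →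
      (∀ E' : ℕ, E' ≠ X → v (a.coeff E') * r ^ E' < v (a.coeff X) * r ^ X) →
      (∀ E' : ℕ, E' ≠ Y → v (dd.coeff E') * r ^ E' < v (dd.coeff Y) * r ^ Y) →
      (∀ E' : ℕ, E' ≠ Z → v (b.coeff E') * r ^ E' < v (b.coeff Z) * r ^ Z) →
      (∀ E' : ℕ, E' ≠ W → v (c.coeff E') * r ^ E' < v (c.coeff W) * r ^ W) →
      X + Y = Z + W →
      v (a.coeff X * dd.coeff Y - b.coeff Z * c.coeff W) = max (v (a.coeff X * dd.coeff Y)) (v (b.coeff Z * c.coeff W)) := by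
    intro r X Y Z W _ haX hdY hbZ hcW _ _ _ _ hS
    obtain ⟨l₁, rfl⟩ := exists_letter_of_coeff_ne_zero d _ haX
    obtain ⟨l₂, rfl⟩ := exists_letter_of_coeff_ne_zero d _ hdY
    obtain ⟨l₃, rfl⟩ := exists_letter_of_coeff_ne_zero d _ hbZ
    obtain ⟨l₄, rfl⟩ := exists_letter_of_coeff_ne_zero d _ hcW
    simp only [ha, hdd, hb, hc, coeff_letterSum_of_injective d hd]
    exact hfree l₁ l₂ l₃ l₄ hS
  have h1 := card_dominant_sub_mul_le v hv a dd b c hAP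
  have h2 := card_dominant_mul_le v hv a dd
  have h3 := card_dominant_mul_le v hv b c
  have h4 := card_dominant_letterSum_le v d (fun l => M l 0 0)
  have h5 := card_dominant_letterSum_le v d (fun l => M l 1 1)
  have h6 := card_dominant_letterSum_le v d (fun l => M l 0 1)
  have h7 := card_dominant_letterSum_le v d (fun l => M l 1 0)
  rw [← ha] at h4
  rw [← hdd] at h5
  rw [← hb] at h6
  rw [← hc] at h7
  omega

/-- **GENERAL `2 × 2` LETTERS, COINCIDENCE BINOMIALS CANCELLATION-FREE ⇒ `npEdges ≤ 4K − 3`, UNFOLDED** (all `K`, every non-archimedean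
field; the binders of the skeleton's `GenValRootLawAt 2 K (4K − 3)` plus injectivity and the cancellation-freeness hypothesis). [corollary] -/
theorem valCoincidenceFree_unfolded :
    ∀ (F : Type) [Field F] (v : AbsoluteValue F ℝ), IsNonarchimedean v →
      ∀ (K : ℕ) (d : Fin K → ℕ) (M : Fin K → Matrix (Fin 2) (Fin 2) F), Function.Injective d →
        (∀ l₁ l₂ l₃ l₄ : Fin K, d l₁ + d l₂ = d l₃ + d l₄ →
          v (M l₁ 0 0 * M l₂ 1 1 - M l₃ 0 1 * M l₄ 1 0) = max (v (M l₁ 0 0 * M l₂ 1 1)) (v (M l₃ 0 1 * M l₄ 1 0))) →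
        ((Matrix.det (∑ l, ((X : F[X]) ^ d l) • (M l).map (C : F →+* F[X]))).support.filter fun E =>
            ∃ r : ℝ, 0 < r ∧ ∀ E' ∈ (Matrix.det (∑ l, ((X : F[X]) ^ d l) • (M l).map (C : F →+* F[X]))).support, E' ≠ E →
              v ((Matrix.det (∑ l, ((X : F[X]) ^ d l) • (M l).map (C : F →+* F[X]))).coeff E') * r ^ E'
                < v ((Matrix.det (∑ l, ((X : F[X]) ^ d l) • (M l).map (C : F →+* F[X]))).coeff E) * r ^ E).card - 1
          ≤ 4 * K - 3 := by
  intro F _ v hv K d M hd hfree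
  have h := card_dominant_det_two_le v hv d hd M hfree
  omega

end Summit.ValiantsHypothesis.ValiantsHypothesis.Theorems.KPlusLogSqLaw.ValDoor
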